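import Summits.Langlands.Langlands.Theses.ParityBlindBianchi
import Literature.NumberTheory.Automorphic.RegularAlgebraicCuspidalHeckePoint
import HarnessLib

/-!
# `TwoAdicBianchiProModularityLevel` (stmt-Langlands-15110), line `Sketch` — stub (A-raw)
# `stub_classicalHeckePoint`, conditional form `stub_classicalHeckePoint_ofFact`

Item `Summit.Langlands.Langlands.Theses.ParityBlindBianchi.TwoAdicBianchiProModularityLevel` (E2′ of
route ParityBlindBianchi).  The registered stub `stub_classicalHeckePoint` of the line skeleton
`Cruxes/TwoAdicBianchiProModularityLevel/Lines/Sketch.lean` — a regular algebraic cuspidal `π₀` of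
`GL₂(𝔸_K)`, `K` imaginary quadratic, unramified at every place over no prime of `S₀ ∋ 2`, is a
continuous integral point of `Spf 𝕋(U₀²)` of the `2`-power Bianchi tower at some tame level `U₀`
hyperspecial off `S₀`, with `T_{v,1} ↦ ι⁻¹(q_v^{1/2} e₁(α_v))`, `T_{v,2} ↦ ι⁻¹(e₂(α_v))` — is the case
`p = 2` of the named literature fact
`Literature.NumberTheory.Automorphic.bianchi_regularAlgebraicCuspidal_isHeckePoint`
(Eichler–Shimura–Harder + Emerton / Scholze, Ann. of Math. 182 §V.4; stated in the crux's vocabulary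
and landed in `Literature/NumberTheory/Automorphic/RegularAlgebraicCuspidalHeckePoint.lean`).  This file proves
the stub CONDITIONALLY on that fact: the fact is prepended as a hypothesis (registered as the stub
`stub_classicalHeckePoint_ofFact`), the signature is otherwise verbatim.  Discharging the hypothesis
(`…_holds`) requires Eichler–Shimura–Harder for Bianchi groups and the Hochschild–Serre reduction of
Scholze's proof of Cor. V.4.2 in Lean — a Literature debt shared with the tree's
`bianchi_cuspidal_regularLAlgebraic_eigenclassExists` / `algebraicWeightEigenclass_continuousPoint`.
-/

noncomputable section

set_option linter.dupNamespace false -- `Summit.Langlands.Langlands` is the mandated namespace (D-0017)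

namespace Summit.Langlands.Langlands.Theorems.TwoAdicBianchiProModularityLevel

/-- REGISTERED STUB `stub_classicalHeckePoint_ofFact` (= the named fact
`Literature.NumberTheory.Automorphic.bianchi_regularAlgebraicCuspidal_isHeckePoint` → the registered stub
`stub_classicalHeckePoint`, verbatim): a regular algebraic cuspidal `π₀` of `GL₂(𝔸_K)` over an
imaginary quadratic `K`, unramified off `S₀ ∋ 2`, is a continuous `𝒪_{ℚ̄₂}`-valued point of the big
Hecke algebra of the `2`-power Bianchi tower at a tame level hyperspecial off `S₀`, with the
Satake–Tamagawa eigenvalues `ι⁻¹(q_v^{1/2} e₁(α_v))`, `ι⁻¹(e₂(α_v))`; the case `p = 2` of the fact.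
[cite: Scholze2015, §V.4, Thm. V.4.1 and proof of Cor. V.4.2] [cite: Harder1987] -/
theorem stub_classicalHeckePoint_ofFact : Literature.NumberTheory.Automorphic.bianchi_regularAlgebraicCuspidal_isHeckePoint → ∀ (K : Type) [Field K] [NumberField K], NumberField.IsTotallyComplex K → Module.finrank ℚ K = 2 → ∀ (ι : PadicAlgCl 2 ≃+* ℂ) (hcpt : Literature.NumberTheory.Automorphic.isCompact_glFiniteIntegralLevel 2 K) (π₀ : Literature.NumberTheory.Automorphic.CuspidalAutomorphicRepData 2 K hcpt), π₀.1.IsRegularAlgebraic → ∀ S₀ : Finset ℕ, 2 ∈ S₀ → (∀ v : IsDedekindDomain.HeightOneSpectrum (NumberField.RingOfIntegers K), (∀ ℓ ∈ S₀, ((ℓ : ℕ) : NumberField.RingOfIntegers K) ∉ v.asIdeal) → π₀.1.IsUnramifiedAt v) → ∃ U₀ : Subgroup (Matrix.GeneralLinearGroup (Fin 2) (IsDedekindDomain.FiniteAdeleRing (NumberField.RingOfIntegers K) K)), IsOpen (U₀ : Set (Matrix.GeneralLinearGroup (Fin 2) (IsDedekindDomain.FiniteAdeleRing (NumberField.RingOfIntegers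 K) K))) ∧ U₀ ≤ Literature.NumberTheory.Automorphic.glFiniteIntegralLevel 2 K ∧ (∀ g ∈ Literature.NumberTheory.Automorphic.glFiniteIntegralLevel 2 K, (∀ v : IsDedekindDomain.HeightOneSpectrum (NumberField.RingOfIntegers K), ¬ (∀ ℓ ∈ S₀, ((ℓ : ℕ) : NumberField.RingOfIntegers K) ∉ v.asIdeal) → ∀ i j : Fin 2, ((g : Matrix (Fin 2) (Fin 2) (IsDedekindDomain.FiniteAdeleRing (NumberField.RingOfIntegers K) K)) i j) v = (1 : Matrix (Fin 2) (Fin 2) (v.adicCompletion K)) i j) → g ∈ U₀) ∧ ∀ (ϖ : ∀ v : IsDedekindDomain.HeightOneSpectrum (NumberField.RingOfIntegers K), (v.adicCompletion K)ˣ), (∀ v : IsDedekindDomain.HeightOneSpectrum (NumberField.RingOfIntegers K), Valued.v ((ϖ v : (v.adicCompletion K)ˣ) : v.adicCompletion K) = WithZero.exp (-1 : ℤ)) → ∃ b : {v : IsDedekindDomain.HeightOneSpectrum (NumberField.RingOfIntegers K) // ∀ ℓ ∈ S₀, ((ℓ : ℕ) : NumberField.RingOfIntegers K) ∉ v.asIdeal}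 → ℕ → (PadicAlgCl.valued 2).v.valuationSubring, (∀ (v : IsDedekindDomain.HeightOneSpectrum (NumberField.RingOfIntegers K)) (hv : ∀ ℓ ∈ S₀, ((ℓ : ℕ) : NumberField.RingOfIntegers K) ∉ v.asIdeal) (α : Multiset ℂ), π₀.1.HasSatakeParamAt v α → ι ((b ⟨v, hv⟩ 1 : (PadicAlgCl.valued 2).v.valuationSubring) : PadicAlgCl 2) = (((Real.sqrt (v.residueCard : ℝ) : ℝ) : ℂ)) * α.esymm 1 ∧ ι ((b ⟨v, hv⟩ 2 : (PadicAlgCl.valued 2).v.valuationSubring) : PadicAlgCl 2) = α.esymm 2) ∧ Literature.NumberTheory.Automorphic.IsHeckePoint (Matrix.GeneralLinearGroup.map (n := Fin 2) (algebraMap K (IsDedekindDomain.FiniteAdeleRing (NumberField.RingOfIntegers K) K))) (Literature.NumberTheory.Automorphic.LevelTower.ofSeq U₀ (fun r : ℕ => (Literature.NumberTheory.Automorphic.principalCongruenceLevel 2 K (Ideal.span {((2 : ℕ) : NumberField.RingOfIntegers K)} ^ r)).map (Literature.NumberTheory.Automorphic.GLn.sndHom 2 K))) ((2 : ℕ) :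 (PadicAlgCl.valued 2).v.valuationSubring) (fun j : {v : IsDedekindDomain.HeightOneSpectrum (NumberField.RingOfIntegers K) // ∀ ℓ ∈ S₀, ((ℓ : ℕ) : NumberField.RingOfIntegers K) ∉ v.asIdeal} × Fin 2 => Literature.NumberTheory.Automorphic.GLn.sndHom 2 K (Literature.NumberTheory.Automorphic.heckeDiagAt 2 K j.1.1 (ϖ j.1.1) (j.2.val + 1))) (fun j => b j.1 (j.2.val + 1)) :=
  fun hX K _ _ htc hdeg ι hcpt π₀ hreg S₀ h2 hur => hX K htc hdeg 2 ι hcpt π₀ hreg S₀ h2 hur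

end Summit.Langlands.Langlands.Theorems.TwoAdicBianchiProModularityLevel

end
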